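import Summits.SmoothPoincare4.SmoothPoincare4.Theorems.SblfDescentRungOneHelperDegreeLift
import Summits.SmoothPoincare4.SmoothPoincare4.Theorems.SblfDescentRungOneHelperDegreeCollapse
import Summits.SmoothPoincare4.SmoothPoincare4.Theorems.SblfDescentRungOneDefs
import HarnessLib

/-!
# Invariance of the transverse winding number

Helper layer `helper_degree_invariance` of the brick `helper_sliceGluing_vanishingDegree` (apex
leaf F0, the degree lemma) of line `Sketch`, crux `SblfDescent.RungOne`
(crux item stmt-SmoothPoincare4-18531).

The degree lemma reads the degree of the loop of vanishing cycles as the winding number `w` of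
the transverse angle map `G` (`helper_degree_tube`) along a base circle
`Γ_{θ,R} : t ↦ ιT (θ, R · circlePt t)` of the torus-side product chart.  Here we prove that this
integer does not depend on the choices:

* `helper_degree_invariance` (registered) — for a product chart `ι : Fb × ℝ² → X` over a
  connected base along which the height is `1 / (1 + 2‖w‖²)`, and any `G` continuous on
  `{height < c}`, the winding of `G ∘ Γ_{θ,R}` is the same for all `θ ∈ Fb` and all radii `R`
  whose level lies below `c` (homotopy invariance, `helper_degree_homotopy`, along a path in `Fb`
  and a segment of radii);
* `helper_degree_invariance_radius` — two transverse angle maps built on tubes of radii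
  `ε'' ≤ ε'` have the same winding along every loop below the level `7ε''²/8`: the finer one is
  the coarser one followed by a degree-one self-map of the circle (an equivariant reparametrisation
  of the lifts, `helper_degree_equivariant_extension`).

## References

* A. Hatcher, *Algebraic Topology* (2002), Thm. 1.7, Prop. 1.30. [HatcherAT2002]
-/

set_option linter.dupNamespace false

noncomputable section

open scoped Manifold ContDiff Topology RealInnerProductSpace
open Set Function Literature.Topology.FourManifolds

namespace Summit.SmoothPoincare4.SmoothPoincare4.Cruxes.RungOne.Sketch

/-- The clamp `w ↦ max (-1/2) (min (1/2) (c w))` for `c ≥ 1` fixes `∓1/2`; its equivariant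
extension reparametrises lifts of the coarse angle map into lifts of the fine one. [folklore] -/
theorem helper_degree_exists_rescale {c : ℝ} (hc : 1 ≤ c) :
    ∃ r : ℝ → ℝ, Continuous r ∧ (∀ (w : ℝ) (k : ℤ), r (w + k) = r w + k) ∧
      ∀ w ∈ Icc (-1 / 2 : ℝ) (1 / 2), r w = max (-1 / 2) (min (1 / 2) (c * w)) := by
  obtain ⟨r, hrc, hr1, hrκ⟩ := helper_degree_equivariant_extension
    (fun w => max (-1 / 2) (min (1 / 2) (c * w)))
    (continuous_const.max (continuous_const.min (continuous_const.mul continuous_id))).continuousOn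
    (by rw [min_eq_right (by nlinarith), max_eq_left (by nlinarith)])
    (by rw [min_eq_left (by nlinarith), max_eq_right (by norm_num)])
  exact ⟨r, hrc, Literature.Topology.PlaneTopology.CircleTwist.apply_add_intCast_of_add_one hr1, hrκ⟩

/-- **Invariance of the transverse winding in the base point and the radius** (registered layer
of the degree lemma `helper_sliceGluing_vanishingDegree`).  Let `ι : Fb × ℝ² → X` be continuous
over a connected manifold `Fb` with height `v₂ f₂ (ι (θ, w)) = 1 / (1 + 2‖w‖²)`, and let
`G : X → 𝕊¹` be continuous on `{v₂ f₂ < c}`.  Then the lifts of `t ↦ G (ι (θ, R · circlePt t))`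
have the same increment for all `θ` and all `R > 0` with `1 / (1 + 2R²) < c`.
[cite: HatcherAT2002, Thm. 1.7] -/
theorem helper_degree_invariance : ∀ (X : Type) [TopologicalSpace X] (f : X → Metric.sphere (0 : EuclideanSpace ℝ (Fin 3)) 1) (v : Metric.sphere (0 : EuclideanSpace ℝ (Fin 3)) 1) (Fb : Type) [TopologicalSpace Fb] [ConnectedSpace Fb] [ChartedSpace (EuclideanSpace ℝ (Fin 2)) Fb] (ι : Fb × EuclideanSpace ℝ (Fin 2) → X), Continuous ι → (∀ (θ : Fb) (w : EuclideanSpace ℝ (Fin 2)), (v : EuclideanSpace ℝ (Fin 3)) 2 * ((f (ι (θ, w)) : Metric.sphere (0 : EuclideanSpace ℝ (Fin 3)) 1) : EuclideanSpace ℝ (Fin 3)) 2 = 1 / (1 + 2 * ‖w‖ ^ 2)) → ∀ (c : ℝ) (G : X → Metric.sphere (0 : EuclideanSpace ℝ (Fin 2)) 1), ContinuousOn G {p : X | (v : EuclideanSpace ℝ (Fin 3)) 2 * ((f p : Metric.sphere (0 : EuclideanSpace ℝ (Fin 3)) 1) : EuclideanSpace ℝ (Fin 3)) 2 < c} → ∀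 (θ θ' : Fb) (R R' : ℝ), 0 < R → 0 < R' → 1 / (1 + 2 * R ^ 2) < c → 1 / (1 + 2 * R' ^ 2) < c → ∀ (L L' : ℝ → ℝ) (k k' : ℤ), Continuous L → Continuous L' → (∀ t, G (ι (θ, R • ((circlePt t : Metric.sphere (0 : EuclideanSpace ℝ (Fin 2)) 1) : EuclideanSpace ℝ (Fin 2)))) = circlePt (L t)) → (∀ t, G (ι (θ', R' • ((circlePt t : Metric.sphere (0 : EuclideanSpace ℝ (Fin 2)) 1) : EuclideanSpace ℝ (Fin 2)))) = circlePt (L' t)) → (∀ t, L (t + 1) = L t + k) → (∀ t, L' (t + 1) = L' t + k') → k = k' := by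
  intro X _ f v Fb _ _ _ ι hι hlev c G hG θ θ' R R' hR hR' hRc hR'c L L' k k' hL hL' hLl hL'l hk hk'
  -- a path from `θ` to `θ'` in the connected manifold `Fb`
  haveI : LocallyPathConnectedSpace Fb :=
    ChartedSpace.locallyPathConnectedSpace (EuclideanSpace ℝ (Fin 2)) Fb
  haveI : PathConnectedSpace Fb := pathConnectedSpace_iff_connectedSpace.2 inferInstance
  let γ : Path θ θ' := (PathConnectedSpace.joined θ θ').somePath
  -- the clamped parameter, the interpolated radius and the homotopy
  set σ : ℝ → unitInterval := projIcc 0 1 zero_le_one with hσ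
  set ρ : ℝ → ℝ := fun s => R + (σ s : ℝ) * (R' - R) with hρ
  have hσc : Continuous σ := continuous_projIcc
  have hρc : Continuous ρ := continuous_const.add ((continuous_subtype_val.comp hσc).mul continuous_const)
  have hρ_between : ∀ s, min R R' ≤ ρ s ∧ ρ s ≤ max R R' := fun s => by
    have h0 : 0 ≤ (σ s : ℝ) := (σ s).2.1
    have h1 : (σ s : ℝ) ≤ 1 := (σ s).2.2
    rw [hρ]
    constructor
    · rcases le_total R R' with h | h
      · rw [min_eq_left h]; nlinarith
      · rw [min_eq_right h]; nlinarith
    · rcases le_total R R' with h | h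
      · rw [max_eq_right h]; nlinarith
      · rw [max_eq_left h]; nlinarith
  have hρ_pos : ∀ s, 0 < ρ s := fun s => lt_of_lt_of_le (lt_min hR hR') (hρ_between s).1
  have hρ_lev : ∀ s, 1 / (1 + 2 * ρ s ^ 2) < c := fun s => by
    rcases le_total R R' with h | h
    · have h1 : R ≤ ρ s := by have := (hρ_between s).1; rwa [min_eq_left h] at this
      calc 1 / (1 + 2 * ρ s ^ 2) ≤ 1 / (1 + 2 * R ^ 2) := by
            apply one_div_le_one_div_of_le (by positivity); nlinarith
        _ < c := hRc
    · have h1 : R' ≤ ρ s := by have := (hρ_between s).1; rwa [min_eq_right h] at this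
      calc 1 / (1 + 2 * ρ s ^ 2) ≤ 1 / (1 + 2 * R' ^ 2) := by
            apply one_div_le_one_div_of_le (by positivity); nlinarith
        _ < c := hR'c
  set Φ : ℝ → ℝ → Metric.sphere (0 : EuclideanSpace ℝ (Fin 2)) 1 := fun s t =>
    G (ι (γ (σ s), ρ s • ((circlePt t : Metric.sphere (0 : EuclideanSpace ℝ (Fin 2)) 1) :
      EuclideanSpace ℝ (Fin 2)))) with hΦ
  have hinner : Continuous fun p : ℝ × ℝ => ι (γ (σ p.1), ρ p.1 •
      ((circlePt p.2 : Metric.sphere (0 : EuclideanSpace ℝ (Fin 2)) 1) : EuclideanSpace ℝ (Fin 2))) :=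
    hι.comp ((γ.continuous.comp (hσc.comp continuous_fst)).prodMk
      ((hρc.comp continuous_fst).smul
        (continuous_subtype_val.comp (continuous_circlePt.comp continuous_snd))))
  have hmem : ∀ p : ℝ × ℝ, ι (γ (σ p.1), ρ p.1 •
      ((circlePt p.2 : Metric.sphere (0 : EuclideanSpace ℝ (Fin 2)) 1) : EuclideanSpace ℝ (Fin 2))) ∈
      {p : X | (v : EuclideanSpace ℝ (Fin 3)) 2 *
        ((f p : Metric.sphere (0 : EuclideanSpace ℝ (Fin 3)) 1) : EuclideanSpace ℝ (Fin 3)) 2 < c} := by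
    intro p
    rw [mem_setOf_eq, hlev, norm_smul, Real.norm_eq_abs, abs_of_pos (hρ_pos _),
      norm_eq_of_mem_sphere, mul_one]
    exact hρ_lev _
  have hΦc : Continuous (uncurry Φ) := hG.comp_continuous hinner hmem
  have hΦper : ∀ s t, Φ s (t + 1) = Φ s t := fun s t => by
    simp only [hΦ, circlePt_add_one]
  obtain ⟨k₀, hk₀⟩ := helper_degree_homotopy' hΦc hΦper
  -- at `s = 0` the loop is `Γ_{θ,R}`, at `s = 1` it is `Γ_{θ',R'}`
  have hσ0 : σ 0 = 0 := projIcc_left _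
  have hσ1 : σ 1 = 1 := projIcc_right _
  have hΦ0 : ∀ t, Φ 0 t = circlePt (L t) := fun t => by
    simp only [hΦ, hρ, hσ0, γ.source]
    rw [← hLl t]; simp
  have hΦ1 : ∀ t, Φ 1 t = circlePt (L' t) := fun t => by
    simp only [hΦ, hρ, hσ1, γ.target]
    rw [← hL'l t]; simp
  have e0 := helper_degree_increment_unique hL hL (fun _ => rfl) hk (hk₀ 0 L hL hΦ0)
  have e1 := helper_degree_increment_unique hL' hL' (fun _ => rfl) hk' (hk₀ 1 L' hL' hΦ1)
  rw [e0, e1]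

/-- Clamping commutes with an expansion `c ≥ 1` followed by clamping. [folklore] -/
theorem helper_degree_clamp_mul_clamp {c : ℝ} (hc : 1 ≤ c) (a : ℝ) :
    max (-1 / 2) (min (1 / 2) (c * max (-1 / 2) (min (1 / 2) a))) = max (-1 / 2) (min (1 / 2) (c * a)) := by
  rcases le_total a (-1 / 2) with ha | ha
  · rw [min_eq_right (by linarith : a ≤ 1 / 2), max_eq_left ha,
      min_eq_right (by nlinarith : c * (-1 / 2) ≤ 1 / 2), max_eq_left (by nlinarith : c * (-1 / 2) ≤ -1 / 2),
      min_eq_right (by nlinarith : c * a ≤ 1 / 2), max_eq_left (by nlinarith : c * a ≤ -1 / 2)]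
  rcases le_total (1 / 2) a with ha' | ha'
  · rw [min_eq_left ha', max_eq_right (by norm_num : (-1 / 2 : ℝ) ≤ 1 / 2),
      min_eq_left (by nlinarith : (1 / 2 : ℝ) ≤ c * (1 / 2)), max_eq_right (by norm_num : (-1 / 2 : ℝ) ≤ 1 / 2),
      min_eq_left (by nlinarith : 1 / 2 ≤ c * a), max_eq_right (by norm_num : (-1 / 2 : ℝ) ≤ 1 / 2)]
  · rw [min_eq_right ha', max_eq_right ha]

/-- **Invariance of the transverse winding in the tube radius.**  Two transverse angle maps
`G'`, `G''` (tube formula `circlePt (clamp (2x₂/ε))` on the `ε`-tube, antipode off it) built on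
radii `ε'' ≤ ε'` have lifts with the same increment along every loop of height `< 7ε''²/8`:
`G'' = ρ ∘ G'` there for a degree-one self-map `ρ` of the circle.
[cite: HatcherAT2002, Thm. 1.7] -/
theorem helper_degree_invariance_radius : ∀ (X : Type) [TopologicalSpace X] [ChartedSpace (EuclideanSpace ℝ (Fin 4)) X] (f : X → Metric.sphere (0 : EuclideanSpace ℝ (Fin 3)) 1) (v : Metric.sphere (0 : EuclideanSpace ℝ (Fin 3)) 1), (v : EuclideanSpace ℝ (Fin 3)) 0 = 0 → (v : EuclideanSpace ℝ (Fin 3)) 1 = 0 → ∀ (ε : ℝ) (ν : (Metric.sphere (0 : EuclideanSpace ℝ (Fin 2)) 1) × EuclideanSpace ℝ (Fin 3) → X), IsFoldTube f v ε ν → ∀ (ε' ε'' : ℝ), 0 < ε'' → ε'' ≤ ε' → ε' < ε → ∀ (G' G'' : X → Metric.sphere (0 : EuclideanSpace ℝ (Fin 2)) 1), (∀ (u : Metric.sphere (0 : EuclideanSpace ℝ (Fin 2)) 1) (y : EuclideanSpace ℝ (Fin 3)), y ∈ Metric.ball (0 : EuclideanSpace ℝ (Fin 3)) ε' → G' (ν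 (u, y)) = circlePt (max (-1 / 2) (min (1 / 2) (2 * y 2 / ε')))) → (∀ p : X, p ∉ ν '' (Set.univ ×ˢ Metric.ball (0 : EuclideanSpace ℝ (Fin 3)) ε') → G' p = circlePt (1 / 2)) → (∀ (u : Metric.sphere (0 : EuclideanSpace ℝ (Fin 2)) 1) (y : EuclideanSpace ℝ (Fin 3)), y ∈ Metric.ball (0 : EuclideanSpace ℝ (Fin 3)) ε'' → G'' (ν (u, y)) = circlePt (max (-1 / 2) (min (1 / 2) (2 * y 2 / ε'')))) → (∀ p : X, p ∉ ν '' (Set.univ ×ˢ Metric.ball (0 : EuclideanSpace ℝ (Fin 3)) ε'') → G'' p = circlePt (1 / 2)) → ∀ (γ : ℝ → X), (∀ t, (v : EuclideanSpace ℝ (Fin 3)) 2 * ((f (γ t) : Metric.sphere (0 : EuclideanSpace ℝ (Fin 3)) 1) : EuclideanSpace ℝ (Fin 3)) 2 < 7 * ε'' ^ 2 / 8) → ∀ (L' L'' : ℝ → ℝ) (k' k'' : ℤ), Continuous L' → Continuous L'' → (∀ t, G' (γ t) = circlePt (L' t)) → (∀ t, G'' (γ t) = circlePt (L'' t)) → (∀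 t, L' (t + 1) = L' t + k') → (∀ t, L'' (t + 1) = L'' t + k'') → k' = k'' := by
  intro X _ _ f v hv0 hv1 ε ν hT ε' ε'' hε'' hε''ε' hε'ε G' G'' hG't hG'o hG''t hG''o γ hγ L' L'' k' k''
    hL' hL'' hL'l hL''l hk' hk''
  have hε' : 0 < ε' := lt_of_lt_of_le hε'' hε''ε'
  set c : ℝ := ε' / ε'' with hc
  have hc1 : 1 ≤ c := by rw [hc, le_div_iff₀ hε'']; linarith
  obtain ⟨r, hrc, hrk, hrκ⟩ := helper_degree_exists_rescale hc1
  have hv2 : (v : EuclideanSpace ℝ (Fin 3)) 2 ^ 2 = 1 := by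
    have hn := norm_eq_of_mem_sphere v
    have : ‖(v : EuclideanSpace ℝ (Fin 3))‖ ^ 2 = 1 := by rw [hn]; norm_num
    rw [EuclideanSpace.norm_eq, Real.sq_sqrt (Finset.sum_nonneg fun i _ => by positivity),
      Fin.sum_univ_three] at this
    simpa [hv0, hv1] using this
  -- pointwise: `G' p = circlePt (clamp a)` and `G'' p = circlePt (clamp (c a))` for some `a`
  have key : ∀ t, ∃ a : ℝ, G' (γ t) = circlePt (max (-1 / 2) (min (1 / 2) a)) ∧
      G'' (γ t) = circlePt (max (-1 / 2) (min (1 / 2) (c * a))) := by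
    intro t
    by_cases h1 : γ t ∈ ν '' (univ ×ˢ Metric.ball (0 : EuclideanSpace ℝ (Fin 3)) ε')
    · obtain ⟨⟨u, y⟩, ⟨-, hy⟩, hp⟩ := h1
      refine ⟨2 * y 2 / ε', by rw [← hp, hG't u y hy], ?_⟩
      have hca : c * (2 * y 2 / ε') = 2 * y 2 / ε'' := by
        rw [hc]; field_simp
      rw [hca]
      by_cases h2 : ‖y‖ < ε''
      · rw [← hp, hG''t u y (mem_ball_zero_iff.2 h2)]
      · -- in the shell `ε'' ≤ ‖y‖ < ε'`: `|y₂| > ε''/4`, the fine clamp saturates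
        have hout : γ t ∉ ν '' (univ ×ˢ Metric.ball (0 : EuclideanSpace ℝ (Fin 3)) ε'') := by
          rintro ⟨⟨u', y'⟩, ⟨-, hy'⟩, hp'⟩
          have hyε : (u, y) ∈ univ ×ˢ Metric.ball (0 : EuclideanSpace ℝ (Fin 3)) ε :=
            ⟨mem_univ _, Metric.mem_ball.2 (lt_trans (Metric.mem_ball.1 hy) hε'ε)⟩
          have hy'ε : (u', y') ∈ univ ×ˢ Metric.ball (0 : EuclideanSpace ℝ (Fin 3)) ε :=
            ⟨mem_univ _, Metric.mem_ball.2 (lt_trans (Metric.mem_ball.1 hy')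
              (lt_of_le_of_lt hε''ε' hε'ε))⟩
          have := hT.injOn hy'ε hyε (hp'.trans hp.symm)
          rw [Prod.mk.injEq] at this
          rw [this.2] at hy'
          exact h2 (mem_ball_zero_iff.1 hy')
        rw [hG''o _ hout]
        have hlev := hγ t
        rw [← hp, (hT.formula u y (Metric.mem_ball.2 (lt_trans (Metric.mem_ball.1 hy) hε'ε))).2.2,
          ← mul_assoc, ← sq, hv2, one_mul] at hlev
        have hsq : ‖y‖ ^ 2 = y 0 ^ 2 + y 1 ^ 2 + y 2 ^ 2 := by
          rw [EuclideanSpace.norm_sq_eq, Fin.sum_univ_three]; simp [sq_abs]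
        have hyn : ε'' ^ 2 ≤ ‖y‖ ^ 2 := pow_le_pow_left₀ hε''.le (not_lt.1 h2) 2
        have hy2 : (ε'' / 4) ^ 2 < y 2 ^ 2 := by
          have : ε'' ^ 2 / 16 < y 2 ^ 2 := by linarith
          calc (ε'' / 4) ^ 2 = ε'' ^ 2 / 16 := by ring
            _ < y 2 ^ 2 := this
        have hab : ε'' / 4 < |y 2| := by
          by_contra hle
          have h' := abs_le.1 (not_lt.1 hle)
          have := sq_le_sq' h'.1 h'.2
          linarith
        rcases lt_abs.1 hab with hpos | hneg
        · rw [min_eq_left (by rw [le_div_iff₀ hε'']; linarith), max_eq_right (by norm_num)]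
        · rw [min_eq_right (by rw [div_le_iff₀ hε'']; linarith),
            max_eq_left (by rw [div_le_iff₀ hε'']; linarith)]
          rw [show (1 / 2 : ℝ) = -1 / 2 + (1 : ℤ) by norm_num]
          exact circlePt_add_int _ _
    · have h2 : γ t ∉ ν '' (univ ×ˢ Metric.ball (0 : EuclideanSpace ℝ (Fin 3)) ε'') := fun h =>
        h1 (image_mono (prod_mono Subset.rfl (Metric.ball_subset_ball hε''ε')) h)
      refine ⟨1 / 2, ?_, ?_⟩
      · rw [hG'o _ h1, min_eq_left le_rfl, max_eq_right (by norm_num)]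
      · rw [hG''o _ h2, min_eq_left (by nlinarith), max_eq_right (by norm_num)]
  -- `r ∘ L'` lifts `G'' ∘ γ`
  have hlift : ∀ t, circlePt (r (L' t)) = circlePt (L'' t) := by
    intro t
    obtain ⟨a, ha', ha''⟩ := key t
    rw [← hL''l, ha'']
    have e := (hL'l t).symm.trans ha'
    obtain ⟨n, hn⟩ := circlePt_eq_circlePt_iff.1 e
    have hmem : max (-1 / 2) (min (1 / 2) a) ∈ Icc (-1 / 2 : ℝ) (1 / 2) :=
      ⟨le_max_left _ _, max_le (by norm_num) (min_le_left _ _)⟩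
    rw [hn, hrk, hrκ _ hmem, helper_degree_clamp_mul_clamp hc1]
    exact circlePt_add_int _ _
  have hM : Continuous fun t => r (L' t) := hrc.comp hL'
  have hMk : ∀ t, r (L' (t + 1)) = r (L' t) + k' := fun t => by rw [hk', hrk]
  exact helper_degree_increment_unique hM hL'' hlift hMk hk''

end Summit.SmoothPoincare4.SmoothPoincare4.Cruxes.RungOne.Sketch

end
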